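import Summits.QuantumFields.YangMills.Theorems.BalabanUVNodesN21ThresholdMixtureRecordChi
import Literature.MathematicalPhysics.QuantumFieldTheory.Balaban1983to89.Node00.SmallFieldChiOfRecord
import Literature.MathematicalPhysics.QuantumFieldTheory.Balaban1983to89.B14Eq218Concrete

/-!
# YM-DAG node N21 (= NE7c) — THE MIXTURE ROAD AT THE RECORD's OWN (2.17)–(2.18) χ-FACTOR (file 13b): def-R's `Node00.chiOfRecord` and the sequence-indexed
# `χ_k(Ω_k)(s)` at def-R's (2.12) datum ARE sharp slot products at the nominal threshold vector, their tested variables are measurable under (H-U), and the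
# COMMON-BOX threshold average of print's SHARP `χ_k(Ω_k)` IS design (η)'s PROFILED `χ_k(Ω_k)` — (O-mix-1) ∕ (O-mix-3′) for the generation-`k` small-field
# function are kernel facts of def-R's letters

Track A of `YM-PLAN.md` (cell `pub-ymgap`, HUMAN RULING D-0062), node **N21** (NE7c, NOT PRINTED); R141 (C) fan-out seat `pub-ymgap-dag-n21-e` (s3 = ALTERNATIVE
CURRENCY), generation 4, file 13b.  THEOREMS ONLY: 0 `def`, 0 `sorry`, standard axioms; COUNT-NEUTRAL; `--supports` the K3′ item `SpineGivenEndpointR12`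
(stmt-QuantumFields-19908) as a helper.  `N`-generic, NO Theses import (restate-immune).  Imports file 13a `BalabanUVNodesN21ThresholdMixtureRecordChi` (the currency:
`chiSmall_eq_smallInd_iSup`, `chi217_eq_prod_smallInd`, `measurable_iSup_dist1`, `commonBox_average_prod_smallInd_eq`, `commonBox_average_weight_eq`), def-R's
`Node00/SmallFieldChiOfRecord.lean` v2 (p487299: `Node00.chiOfRecord`, `chiOfRecord_eq_chi217`, `epsOfRecord`, `cubeIndices`, `cubeSide`, `cubeEnl`, `plaqInside`,
`bgOfRecord`, `avOfRecord`) and r11's `B14Eq218Concrete` (`chi218`, `cubesIn`, `Seq`).  FILE 4's term-indexed `Node00.chiSeqOfRecord F N ν M g K k s` IS this file's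
`chi218` instance at the domain class `D = Node00.DOfRecord F ν M g K` (`Node00.chiSeqOfRecord_eq`, `rfl`), and K0b's displayed clause (H-U) `Node00.LocalBgMeasurable F N ν`
(`Node00/Record12Measurability.lean`) IS this file's measurability hypothesis read at `(K, k, □^{∼4})` — both taken BY VALUE, nothing of theirs restated.
Restates nothing; cites by name.  [III] = [Balaban1988Convergent].

WHY (see file 13a's header for the road).  The mixture road's located inputs (O-mix-1) (threshold-free sharp representation) and (O-mix-3′) (occurrence
structure) are, for the generation-`k` small-field function (2.17) [III] p. 257, facts about def-R's letters: the OCCURRENCES are the cubes `□` of the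
`L^{k+1}M₂R_k`-partition (`cubeIndices …`; one nominal threshold `ε_kη_k²`, positive in print's range by `Node00.epsOfRecord_pos`), a term `s` reads the sub-family
`cubesIn … (s.Ω k)` (coordinate map = inclusion), each factor is `smallInd (u_□(V)) (ε_kη_k²)` with the threshold-free block-sup `u_□(V) = sup_{p ⊂ □^∼} |U_{k,□}(V)(∂p) − 1|`
of `dist1 ∘ plaqHol ∘ ukBox (bgOfRecord …)`, and averaging the per-cube-threshold sharp product over the common box `⊗_{□} Leb|[(1 − κ)ε_kη_k², ε_kη_k²]` (ONE multiplier
per cube, all cubes of the step) gives EXACTLY design (η)'s profiled `∏_{□} linProfile κ (u_□(V) ∕ ε_kη_k²)` — pointwise in `V`, and against any integrable remainder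
(print: FILE 4's residual `(𝐓_k e^{A_k})(s)` times the dressed start of `Node00/DressedSlotsOfRecord12`) under any s-finite field law as the `hXs`∕`hA` PAIR of the K5 readings
`…N21AtSpineCarriersMixtureCommonBox.s_N21_of_sharpCommonBoxReading` (p479591) ∕ `…TwoThresholdsCommonBox…` (p483387).  On the DIAGONAL `S ≡ ε_kη_k²` the sharp family IS
print's `χ_k` verbatim.

WHAT IS PROVED ([folklore] bookkeeping over [III] (2.17)–(2.18); nothing of Bałaban's asserted).  ★ `chiOfRecord_eq_prod_smallInd` · ★ `chi218_record_eq_prod_smallInd` ·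
`measurable_recordStat` ((H-U) by value ⇒ the `meas` binder of the K5 readings at the record's χ-slots) · ★★ `commonBox_average_chi218_record_eq_profile` («(η)'s profiled
χ_k(Ω_k)(s) IS 𝔼_λ of print's SHARP χ_k(Ω_k)(s) at thresholds λ_□ε_kη_k², one multiplier per cube») · ★ `commonBox_average_recordWeight_eq_profile` (the `hXs`∕`hA` pair) ·
`commonBox_average_chiOfRecord_eq_profile` (the whole-lattice face `Ω_k = T_η`, [B16] (0.1)'s `χ_k`, with the diagonal = `Node00.chiOfRecord`).

HONEST FRAMING.  COUNT-NEUTRAL; N21 NOT discharged; NE7c NOT PRINTED ∕ NOT proved.  (O-mix-1)∕(O-mix-3′) typed for the generation-`k` factor `χ_k(Ω_k)` ONLY — the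
𝐓-operation's (3.3)∕(3.16) functions and the 𝐑-operation's (1.22) [Balaban1989LargeFieldI] functions are OTHER occurrences (def-T's `TkWeightsOfRecord` ∕ `RStepSlotOfRecord`;
lens ROW T-2, (t-n′)); the mixture is a convex combination of print's SHARP procedure over admissible threshold vectors — NOT print verbatim; (M1) for print's
deterministic sharp procedure untouched; N16 `SupClose`, N20's sharp class-relative bounds, `ρ`, `Wsh` displayed as in files 10b ∕ 11b ∕ 12.  One finite `T⁴`
programme at fixed `ε`, Bałaban as printed; nothing continuum ∕ ℝ⁴ ∕ OS ∕ mass-gap ∕ Clay.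
-/

noncomputable section

open MeasureTheory Set
open scoped BigOperators ENNReal

namespace Summit.QuantumFields.YangMills.Theorems.N21ThresholdMixtureRecordChiAtRecord

open Literature.MathematicalPhysics.QuantumFieldTheory.Balaban1983to89
open Literature.MathematicalPhysics.QuantumFieldTheory.Balaban1983to89.T4IndicatorShell
open Literature.MathematicalPhysics.QuantumFieldTheory.Balaban1983to89.T4LipschitzCutoff
open Summit.QuantumFields.YangMills.Theorems.N21ThresholdMixture
open Summit.QuantumFields.YangMills.Theorems.N21ThresholdMixtureRecordChi

/-! ## At the record: def-R's `χ_k(T_η)` and the sequence-indexed `χ_k(Ω_k)(s)` at def-R's datum, in the mixture road's currency -/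

section AtRecord

open Literature.MathematicalPhysics.QuantumFieldTheory.Balaban1983to89.Node00
open T4Continuum B15DeterminingSets B14.Eq213DetSet B14.Eq216Concrete B14.Eq213MaximalDomains B15Eq112TorusCover B14DomainGeom
  B14.Eq218Concrete

variable (F : T4Family) (N : ℕ) [NeZero N]

/-- ★ **`χ_k(T_η)` OF RECORD IS A SHARP SLOT PRODUCT AT THE NOMINAL THRESHOLD VECTOR.**  For a positive level threshold `ε_kη_k² > 0` (print's range
`0 < g_k < 1`, `0 < A₀`: def-R's `Node00.epsOfRecord_pos` and `η_k = L^{−k} > 0`): def-R's `Node00.chiOfRecord F N ν g K k V` = `∏_{□ ∈ cubeIndices} smallInd (u_□(V)) (ε_kη_k²)`,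
the tested variable of cube `□` being the THRESHOLD-FREE block-sup `u_□(V) = sup_{p ⊂ □^∼} |U_{k,□}(V)(∂p) − 1|` of `dist1 ∘ plaqHol ∘ ukBox` (dag-n21-d's
`N21SlotTestAtRecord.chiOfRecord_eq_prod_slots` is the same product in `chiSmall` currency). [cite: Balaban1988Convergent, (2.17) p.257] -/
theorem chiOfRecord_eq_prod_smallInd (ν : Stage7Numerics) (g : ℕ → ℝ) (K k : ℕ) (hε : 0 < epsOfRecord ν g k * (F.P K).eta k ^ 2)
    (V : GaugeField (F.P K) k (SU N)) :
    chiOfRecord F N ν g K k V =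
      ∏ a ∈ cubeIndices (F.P K) (cubeSide (F.P K).L ν.M₂ (RkOfRecord (F.P K).L ν.r (g k)) k),
        smallInd
          (⨆ p : ↥(plaqInside (cubeEnl (F.P K) (cubeSide (F.P K).L ν.M₂ (RkOfRecord (F.P K).L ν.r (g k)) k) a 1)),
            dist1 (GaugeField.plaqHol
              (ukBox (bgOfRecord (avOfRecord F N K) {U | PlaqSmall (ν.εreg * (F.P K).eta k ^ 2) U}) ν.M₁
                (cubeEnl (F.P K) (cubeSide (F.P K).L ν.M₂ (RkOfRecord (F.P K).L ν.r (g k)) k) a 4) k V) p.1))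
          (epsOfRecord ν g k * (F.P K).eta k ^ 2) := by
  rw [chiOfRecord_eq_chi217]
  exact chi217_eq_prod_smallInd _ _ _ _ _ k hε V

/-- ★ **`χ_k(Ω_k)(s)` AT def-R's DATUM IS A SHARP SLOT PRODUCT over the term's OWN occurrences.**  For an admissible sequence `s` of any domain class `D` (FILE 4's
`Node00.SeqOfRecord` is `D = DOfRecord …`, and then the left side IS `Node00.chiSeqOfRecord F N ν M g K k s` by FILE 4's `Node00.chiSeqOfRecord_eq`, `rfl`): r11's (2.18)
factor `chi218` at def-R's (2.12) datum, the record's `L^{k+1}M₂R_k`-cubes and `ε_k` of record = `∏_{□ ∈ cubesIn … (s.Ω k)} smallInd (u_□(V)) (ε_kη_k²)` — the cubes of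
the sequence's last small-field domain, a sub-family of ALL cubes `↥(cubeIndices …)` of the step ((O-mix-3′): the term's coordinate map is this inclusion).
[cite: Balaban1988Convergent, (2.17)–(2.18) p.257] -/
theorem chi218_record_eq_prod_smallInd (ν : Stage7Numerics) (g : ℕ → ℝ) (K k : ℕ)
    (hε : 0 < epsOfRecord ν g k * (F.P K).eta k ^ 2) {D : ℕ → Set (Set (Site (F.P K) 0))} (s : Seq D k)
    (V : GaugeField (F.P K) k (SU N)) :
    chi218 (ι := ↥(cubeIndices (F.P K) (cubeSide (F.P K).L ν.M₂ (RkOfRecord (F.P K).L ν.r (g k)) k)))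
        (bgOfRecord (avOfRecord F N K) {U | PlaqSmall (ν.εreg * (F.P K).eta k ^ 2) U}) ν.M₁
        (fun a => cubeEnl (F.P K) (cubeSide (F.P K).L ν.M₂ (RkOfRecord (F.P K).L ν.r (g k)) k) a 0)
        (fun a => plaqInside (cubeEnl (F.P K) (cubeSide (F.P K).L ν.M₂ (RkOfRecord (F.P K).L ν.r (g k)) k) a 1))
        (fun a => cubeEnl (F.P K) (cubeSide (F.P K).L ν.M₂ (RkOfRecord (F.P K).L ν.r (g k)) k) a 4)
        (epsOfRecord ν g k) k s V =
      ∏ c ∈ cubesIn (fun a : ↥(cubeIndices (F.P K) (cubeSide (F.P K).L ν.M₂ (RkOfRecord (F.P K).L ν.r (g k)) k)) =>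
          cubeEnl (F.P K) (cubeSide (F.P K).L ν.M₂ (RkOfRecord (F.P K).L ν.r (g k)) k) a 0) (s.Ω k),
        smallInd
          (⨆ p : ↥(plaqInside (cubeEnl (F.P K) (cubeSide (F.P K).L ν.M₂ (RkOfRecord (F.P K).L ν.r (g k)) k) c 1)),
            dist1 (GaugeField.plaqHol
              (ukBox (bgOfRecord (avOfRecord F N K) {U | PlaqSmall (ν.εreg * (F.P K).eta k ^ 2) U}) ν.M₁
                (cubeEnl (F.P K) (cubeSide (F.P K).L ν.M₂ (RkOfRecord (F.P K).L ν.r (g k)) k) c 4) k V) p.1))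
          (epsOfRecord ν g k * (F.P K).eta k ^ 2) := by
  rw [chi218_apply]
  exact Finset.prod_congr rfl fun c _ => chiSmall_eq_smallInd_iSup (Or.inr hε) _

/-- **THE `meas` BINDER AT THE RECORD's χ-SLOTS.**  If the (2.16) local background of record on `□^{∼4}` is a measurable map of the field — K0b's displayed clause
(H-U) `Node00.LocalBgMeasurable F N ν` (`Node00/Record12Measurability.lean`) read at `(K, k, □^{∼4})`, taken here BY VALUE — then the tested variable `u_□` of the record
is measurable: the `meas` hypothesis of the K5 readings (`…N21AtSpineCarriersMixtureCommonBox.s_N21_of_sharpCommonBoxReading` &c.) for the generation-`k` χ-slots.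
[cite: Balaban1988Convergent, (2.16)–(2.17) p.257 (bookkeeping)] -/
theorem measurable_recordStat (ν : Stage7Numerics) (g : ℕ → ℝ) (K k : ℕ) (a : Pt (F.P K).d)
    (hU : Measurable (ukBox (bgOfRecord (avOfRecord F N K) {U | PlaqSmall (ν.εreg * (F.P K).eta k ^ 2) U}) ν.M₁
      (cubeEnl (F.P K) (cubeSide (F.P K).L ν.M₂ (RkOfRecord (F.P K).L ν.r (g k)) k) a 4) k)) :
    Measurable fun V : GaugeField (F.P K) k (SU N) =>
      ⨆ p : ↥(plaqInside (cubeEnl (F.P K) (cubeSide (F.P K).L ν.M₂ (RkOfRecord (F.P K).L ν.r (g k)) k) a 1)),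
        dist1 (GaugeField.plaqHol
          (ukBox (bgOfRecord (avOfRecord F N K) {U | PlaqSmall (ν.εreg * (F.P K).eta k ^ 2) U}) ν.M₁
            (cubeEnl (F.P K) (cubeSide (F.P K).L ν.M₂ (RkOfRecord (F.P K).L ν.r (g k)) k) a 4) k V) p.1) :=
  (measurable_iSup_dist1 _).comp hU

/-- ★★ **(η)'s PROFILED `χ_k(Ω_k)` IS THE COMMON-BOX AVERAGE OF PRINT's SHARP `χ_k(Ω_k)`.**  Generation `k`, sequence `s` (any domain class), field `V`; the occurrences
are ALL cubes `c : ↥(cubeIndices …)` of the step, ONE threshold coordinate per cube, window `[(1 − κ)ε_kη_k², ε_kη_k²]` (`0 < κ`, `0 < ε_kη_k²`).  The normalised average over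
this common box of the per-cube-threshold sharp product `∏_{□ ∈ cubesIn … (s.Ω k)} smallInd (u_□(V)) (S □)` — print's (2.17)∕(2.18) factor run SHARP at the threshold vector
`S`, which at `S ≡ ε_kη_k²` IS the record's `χ_k(Ω_k)(s)` (`chi218_record_eq_prod_smallInd`) — equals `∏_{□ ∈ cubesIn … (s.Ω k)} linProfile κ (u_□(V) ∕ ε_kη_k²)`: design (η)'s
Lipschitz-profiled small-field function (`T4LipschitzCutoff.linProfile κ`, relative width `κ` below the nominal threshold) at the SAME objects.  Lens Card 5 (i) at the
record's own letter. [cite: Balaban1988Convergent, (2.17)–(2.18) p.257] -/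
theorem commonBox_average_chi218_record_eq_profile (ν : Stage7Numerics) (g : ℕ → ℝ) (K k : ℕ) {κ : ℝ} (hκ : 0 < κ)
    (hε : 0 < epsOfRecord ν g k * (F.P K).eta k ^ 2) {D : ℕ → Set (Set (Site (F.P K) 0))} (s : Seq D k)
    (V : GaugeField (F.P K) k (SU N)) :
    (∏ _c : ↥(cubeIndices (F.P K) (cubeSide (F.P K).L ν.M₂ (RkOfRecord (F.P K).L ν.r (g k)) k)),
        (κ * (epsOfRecord ν g k * (F.P K).eta k ^ 2)))⁻¹ *
      ∫ S, ∏ c ∈ cubesIn (fun a : ↥(cubeIndices (F.P K) (cubeSide (F.P K).L ν.M₂ (RkOfRecord (F.P K).L ν.r (g k)) k)) =>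
            cubeEnl (F.P K) (cubeSide (F.P K).L ν.M₂ (RkOfRecord (F.P K).L ν.r (g k)) k) a 0) (s.Ω k),
          smallInd
            (⨆ p : ↥(plaqInside (cubeEnl (F.P K) (cubeSide (F.P K).L ν.M₂ (RkOfRecord (F.P K).L ν.r (g k)) k) c 1)),
              dist1 (GaugeField.plaqHol
                (ukBox (bgOfRecord (avOfRecord F N K) {U | PlaqSmall (ν.εreg * (F.P K).eta k ^ 2) U}) ν.M₁
                  (cubeEnl (F.P K) (cubeSide (F.P K).L ν.M₂ (RkOfRecord (F.P K).L ν.r (g k)) k) c 4) k V) p.1))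
            (S c)
        ∂(Measure.pi fun _c : ↥(cubeIndices (F.P K) (cubeSide (F.P K).L ν.M₂ (RkOfRecord (F.P K).L ν.r (g k)) k)) =>
            volume.restrict (Icc ((1 - κ) * (epsOfRecord ν g k * (F.P K).eta k ^ 2)) (epsOfRecord ν g k * (F.P K).eta k ^ 2)))
      = ∏ c ∈ cubesIn (fun a : ↥(cubeIndices (F.P K) (cubeSide (F.P K).L ν.M₂ (RkOfRecord (F.P K).L ν.r (g k)) k)) =>
            cubeEnl (F.P K) (cubeSide (F.P K).L ν.M₂ (RkOfRecord (F.P K).L ν.r (g k)) k) a 0) (s.Ω k),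
          linProfile κ
            ((⨆ p : ↥(plaqInside (cubeEnl (F.P K) (cubeSide (F.P K).L ν.M₂ (RkOfRecord (F.P K).L ν.r (g k)) k) c 1)),
              dist1 (GaugeField.plaqHol
                (ukBox (bgOfRecord (avOfRecord F N K) {U | PlaqSmall (ν.εreg * (F.P K).eta k ^ 2) U}) ν.M₁
                  (cubeEnl (F.P K) (cubeSide (F.P K).L ν.M₂ (RkOfRecord (F.P K).L ν.r (g k)) k) c 4) k V) p.1)) /
              (epsOfRecord ν g k * (F.P K).eta k ^ 2)) :=
  commonBox_average_prod_smallInd_eq _ (fun _ => κ) (fun _ => epsOfRecord ν g k * (F.P K).eta k ^ 2) _ (fun _ => hκ) fun _ => hε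

/-- ★ **THE `hXs`∕`hA` PAIR AT THE RECORD's χ-FACTOR.**  For ANY integrable remainder density `R` (print: FILE 4's residual `(𝐓_k e^{A_k})(s)` times the dressed start of
`Node00/DressedSlotsOfRecord12`) under ANY s-finite law `μ` on the level-`k` fields, and (H-U) by value at the cubes of the step: the normalised common-box average of the
THRESHOLD-FREE SHARP WEIGHT `S ↦ ∫ (∏_{□ ∈ cubesIn …} smallInd (u_□ V) (S □)) · R V ∂μ` IS the PROFILED weight `∫ (∏_{□} linProfile κ (u_□ V ∕ ε_kη_k²)) · R V ∂μ` — the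
carriers-as-threshold-averages clause of the mixture road's K5 readings (files 6 ∕ 10b ∕ 11b), instantiated for the generation-`k` small-field factor of record.
[cite: Balaban1988Convergent, (2.17)–(2.18) p.257] -/
theorem commonBox_average_recordWeight_eq_profile (ν : Stage7Numerics) (g : ℕ → ℝ) (K k : ℕ) {κ : ℝ} (hκ : 0 < κ)
    (hε : 0 < epsOfRecord ν g k * (F.P K).eta k ^ 2)
    (hU : ∀ a : Pt (F.P K).d, Measurable (ukBox (bgOfRecord (avOfRecord F N K) {U | PlaqSmall (ν.εreg * (F.P K).eta k ^ 2) U}) ν.M₁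
      (cubeEnl (F.P K) (cubeSide (F.P K).L ν.M₂ (RkOfRecord (F.P K).L ν.r (g k)) k) a 4) k))
    {D : ℕ → Set (Set (Site (F.P K) 0))} (s : Seq D k)
    (μ : Measure (GaugeField (F.P K) k (SU N))) [SFinite μ] {R : GaugeField (F.P K) k (SU N) → ℝ} (hR : Integrable R μ) :
    (∏ _c : ↥(cubeIndices (F.P K) (cubeSide (F.P K).L ν.M₂ (RkOfRecord (F.P K).L ν.r (g k)) k)),
        (κ * (epsOfRecord ν g k * (F.P K).eta k ^ 2)))⁻¹ *
      ∫ S, (∫ V, (∏ c ∈ cubesIn (fun a : ↥(cubeIndices (F.P K) (cubeSide (F.P K).L ν.M₂ (RkOfRecord (F.P K).L ν.r (g k)) k)) =>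
            cubeEnl (F.P K) (cubeSide (F.P K).L ν.M₂ (RkOfRecord (F.P K).L ν.r (g k)) k) a 0) (s.Ω k),
          smallInd
            (⨆ p : ↥(plaqInside (cubeEnl (F.P K) (cubeSide (F.P K).L ν.M₂ (RkOfRecord (F.P K).L ν.r (g k)) k) c 1)),
              dist1 (GaugeField.plaqHol
                (ukBox (bgOfRecord (avOfRecord F N K) {U | PlaqSmall (ν.εreg * (F.P K).eta k ^ 2) U}) ν.M₁
                  (cubeEnl (F.P K) (cubeSide (F.P K).L ν.M₂ (RkOfRecord (F.P K).L ν.r (g k)) k) c 4) k V) p.1))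
            (S c)) * R V ∂μ)
        ∂(Measure.pi fun _c : ↥(cubeIndices (F.P K) (cubeSide (F.P K).L ν.M₂ (RkOfRecord (F.P K).L ν.r (g k)) k)) =>
            volume.restrict (Icc ((1 - κ) * (epsOfRecord ν g k * (F.P K).eta k ^ 2)) (epsOfRecord ν g k * (F.P K).eta k ^ 2)))
      = ∫ V, (∏ c ∈ cubesIn (fun a : ↥(cubeIndices (F.P K) (cubeSide (F.P K).L ν.M₂ (RkOfRecord (F.P K).L ν.r (g k)) k)) =>
            cubeEnl (F.P K) (cubeSide (F.P K).L ν.M₂ (RkOfRecord (F.P K).L ν.r (g k)) k) a 0) (s.Ω k),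
          linProfile κ
            ((⨆ p : ↥(plaqInside (cubeEnl (F.P K) (cubeSide (F.P K).L ν.M₂ (RkOfRecord (F.P K).L ν.r (g k)) k) c 1)),
              dist1 (GaugeField.plaqHol
                (ukBox (bgOfRecord (avOfRecord F N K) {U | PlaqSmall (ν.εreg * (F.P K).eta k ^ 2) U}) ν.M₁
                  (cubeEnl (F.P K) (cubeSide (F.P K).L ν.M₂ (RkOfRecord (F.P K).L ν.r (g k)) k) c 4) k V) p.1)) /
              (epsOfRecord ν g k * (F.P K).eta k ^ 2))) * R V ∂μ :=
  commonBox_average_weight_eq μ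
    (cubesIn (fun a : ↥(cubeIndices (F.P K) (cubeSide (F.P K).L ν.M₂ (RkOfRecord (F.P K).L ν.r (g k)) k)) =>
      cubeEnl (F.P K) (cubeSide (F.P K).L ν.M₂ (RkOfRecord (F.P K).L ν.r (g k)) k) a 0) (s.Ω k))
    (fun _ => κ) (fun _ => epsOfRecord ν g k * (F.P K).eta k ^ 2)
    (u := fun (c : ↥(cubeIndices (F.P K) (cubeSide (F.P K).L ν.M₂ (RkOfRecord (F.P K).L ν.r (g k)) k)))
        (V : GaugeField (F.P K) k (SU N)) =>
      ⨆ p : ↥(plaqInside (cubeEnl (F.P K) (cubeSide (F.P K).L ν.M₂ (RkOfRecord (F.P K).L ν.r (g k)) k) c 1)),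
        dist1 (GaugeField.plaqHol
          (ukBox (bgOfRecord (avOfRecord F N K) {U | PlaqSmall (ν.εreg * (F.P K).eta k ^ 2) U}) ν.M₁
            (cubeEnl (F.P K) (cubeSide (F.P K).L ν.M₂ (RkOfRecord (F.P K).L ν.r (g k)) k) c 4) k V) p.1))
    (R := R) (fun c _ => measurable_recordStat F N ν g K k c.1 (hU c.1)) hR (fun _ => hκ) fun _ => hε

/-- **THE WHOLE-LATTICE FACE** (`Ω_k = T_η`, the `χ_k = χ_k(T_η)` of [B16] (0.1)): the normalised common-box average of the per-cube-threshold sharp product over ALL cubes is the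
profiled product over all cubes, and on the DIAGONAL `S ≡ ε_kη_k²` that sharp product IS def-R's `Node00.chiOfRecord` — print verbatim at the corner of the box, the mixture a
convex combination of print's own procedure. [cite: Balaban1988Convergent, (2.17) p.257; Balaban1989LargeFieldII, (0.1) p.355] -/
theorem commonBox_average_chiOfRecord_eq_profile (ν : Stage7Numerics) (g : ℕ → ℝ) (K k : ℕ) {κ : ℝ} (hκ : 0 < κ)
    (hε : 0 < epsOfRecord ν g k * (F.P K).eta k ^ 2) (V : GaugeField (F.P K) k (SU N)) :
    (∏ _c : ↥(cubeIndices (F.P K) (cubeSide (F.P K).L ν.M₂ (RkOfRecord (F.P K).L ν.r (g k)) k)),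
        (κ * (epsOfRecord ν g k * (F.P K).eta k ^ 2)))⁻¹ *
      ∫ S, ∏ c ∈ (Finset.univ : Finset ↥(cubeIndices (F.P K) (cubeSide (F.P K).L ν.M₂ (RkOfRecord (F.P K).L ν.r (g k)) k))),
          smallInd
            (⨆ p : ↥(plaqInside (cubeEnl (F.P K) (cubeSide (F.P K).L ν.M₂ (RkOfRecord (F.P K).L ν.r (g k)) k) c 1)),
              dist1 (GaugeField.plaqHol
                (ukBox (bgOfRecord (avOfRecord F N K) {U | PlaqSmall (ν.εreg * (F.P K).eta k ^ 2) U}) ν.M₁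
                  (cubeEnl (F.P K) (cubeSide (F.P K).L ν.M₂ (RkOfRecord (F.P K).L ν.r (g k)) k) c 4) k V) p.1))
            (S c)
        ∂(Measure.pi fun _c : ↥(cubeIndices (F.P K) (cubeSide (F.P K).L ν.M₂ (RkOfRecord (F.P K).L ν.r (g k)) k)) =>
            volume.restrict (Icc ((1 - κ) * (epsOfRecord ν g k * (F.P K).eta k ^ 2)) (epsOfRecord ν g k * (F.P K).eta k ^ 2)))
      = ∏ c ∈ (Finset.univ : Finset ↥(cubeIndices (F.P K) (cubeSide (F.P K).L ν.M₂ (RkOfRecord (F.P K).L ν.r (g k)) k))),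
          linProfile κ
            ((⨆ p : ↥(plaqInside (cubeEnl (F.P K) (cubeSide (F.P K).L ν.M₂ (RkOfRecord (F.P K).L ν.r (g k)) k) c 1)),
              dist1 (GaugeField.plaqHol
                (ukBox (bgOfRecord (avOfRecord F N K) {U | PlaqSmall (ν.εreg * (F.P K).eta k ^ 2) U}) ν.M₁
                  (cubeEnl (F.P K) (cubeSide (F.P K).L ν.M₂ (RkOfRecord (F.P K).L ν.r (g k)) k) c 4) k V) p.1)) /
              (epsOfRecord ν g k * (F.P K).eta k ^ 2)) ∧
    (∏ c ∈ (Finset.univ : Finset ↥(cubeIndices (F.P K) (cubeSide (F.P K).L ν.M₂ (RkOfRecord (F.P K).L ν.r (g k)) k))),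
          smallInd
            (⨆ p : ↥(plaqInside (cubeEnl (F.P K) (cubeSide (F.P K).L ν.M₂ (RkOfRecord (F.P K).L ν.r (g k)) k) c 1)),
              dist1 (GaugeField.plaqHol
                (ukBox (bgOfRecord (avOfRecord F N K) {U | PlaqSmall (ν.εreg * (F.P K).eta k ^ 2) U}) ν.M₁
                  (cubeEnl (F.P K) (cubeSide (F.P K).L ν.M₂ (RkOfRecord (F.P K).L ν.r (g k)) k) c 4) k V) p.1))
            (epsOfRecord ν g k * (F.P K).eta k ^ 2)
        = chiOfRecord F N ν g K k V) := by
  refine ⟨commonBox_average_prod_smallInd_eq _ (fun _ => κ) (fun _ => epsOfRecord ν g k * (F.P K).eta k ^ 2) _ (fun _ => hκ)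
    fun _ => hε, ?_⟩
  rw [chiOfRecord_eq_prod_smallInd F N ν g K k hε V]
  exact Finset.prod_coe_sort (cubeIndices (F.P K) (cubeSide (F.P K).L ν.M₂ (RkOfRecord (F.P K).L ν.r (g k)) k)) fun a =>
    smallInd
      (⨆ p : ↥(plaqInside (cubeEnl (F.P K) (cubeSide (F.P K).L ν.M₂ (RkOfRecord (F.P K).L ν.r (g k)) k) a 1)),
        dist1 (GaugeField.plaqHol
          (ukBox (bgOfRecord (avOfRecord F N K) {U | PlaqSmall (ν.εreg * (F.P K).eta k ^ 2) U}) ν.M₁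
            (cubeEnl (F.P K) (cubeSide (F.P K).L ν.M₂ (RkOfRecord (F.P K).L ν.r (g k)) k) a 4) k V) p.1))
      (epsOfRecord ν g k * (F.P K).eta k ^ 2)

end AtRecord

end Summit.QuantumFields.YangMills.Theorems.N21ThresholdMixtureRecordChiAtRecord

end
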